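import Summits.ValiantsHypothesis.ValiantsHypothesis.Theorems.LacunarySymmetroidMatrixDescartesPivotRankOneCriticalWindowsFourBranchZero
import Summits.ValiantsHypothesis.ValiantsHypothesis.Theorems.LacunarySymmetroidMatrixDescartesCensusSecularRolle

/-!
# `MatrixDescartes` census — rank-one `(2,4)₁`, lone letter: THE BRANCH-0 FUNCTION IS DIFFERENTIABLE (implicit function theorem), with the
# implicit-differentiation formula

HONEST FRAMING.  Object-search cell `pub-symmetroid`, seat `val-sym-mdr-p1` (generation 22); helper file `--supports` the crux item
stmt-ValiantsHypothesis-18050 (`Theses.LacunarySymmetroid.MatrixDescartes`, OPEN, on HOLD) with NO closure claim.  Fifth kernel piece of the `K = 4` lone-letter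
programme (seat memo LONE-LETTER.md §8b–§8f): the derivative of the branch-0 function of `…FourBranchZero.branch0_function`, via Mathlib's curried bivariate
implicit function theorem (`implicitFunctionOfBivariate`).  With it, every smooth function of `(T, φ T)` — in particular `h₂` along the branch, whose zeros against
a level are the critical directions — can be differentiated along the branch; the remaining located statements of the programme ((F1c), (F2) of the memo) are
sign statements about that derivative.  No count is proved; nothing bears on `MatrixDescartes` in its window, on `DoorA26` / `DoorA34`, registers / credences,
or `VP ≠ VNP`.

* §1 `implicit_hasDerivAt` — GENERIC: if `F(T, x)` has continuous partial derivatives `F_T, F_x` everywhere, `φ` is continuous on an open set `s` with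
  `F(T, φ T) = 0` on `s`, and `F_x(T₀, φ T₀) ≠ 0` at `T₀ ∈ s`, then `φ` has derivative `−F_T/F_x` at `T₀` (the local implicit function of the bivariate IFT
  coincides with `φ` near `T₀` by continuity of `φ` and the theorem's uniqueness clause). [folklore]
* **§2 `branch0_hasDerivAt`** — the branch-0 function `φ` of the four-letter window profile (lone letter `j`, free pair `(i,k)`) is differentiable on the right
  window with `φ′(T) = −F_T(T, φ T)/F_x(T, φ T)` for `F(T,x) = wᵢx^{dᵢ}(−M_{ji}) + wₖx^{dₖ}(−M_{jk}) − w₀x^{d₀}(−M_{0j})`; `F_x(T, φ T) > 0` there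
  (`x·F_x = wᵢ(dᵢ−d₀)x^{dᵢ}(−M_{ji}) + wₖ(dₖ−d₀)x^{dₖ}(−M_{jk})` on the branch). [folklore]
[folklore] Implicit function theorem (Mathlib `implicitFunctionOfBivariate`), the companions' algebra; `x·(n x^{n−1}) = n x^n` is cited from
`…CensusSecularRolle.mul_natCast_mul_pow_pred`.  No definitions, no named facts.
-/

-- `Summit.ValiantsHypothesis.ValiantsHypothesis.…` repeats a component by the D-0017 layout
-- (single-conjunct summit), which the `dupNamespace` linter flags; the name is mandated.
set_option linter.dupNamespace false

open Filter Topology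

namespace Summit.ValiantsHypothesis.ValiantsHypothesis.Theorems.LacunarySymmetroidMatrixDescartes.Pivot.CriticalWindows.Four

open Summit.ValiantsHypothesis.ValiantsHypothesis.Theorems.LacunarySymmetroidMatrixDescartes.Pivot.CriticalWindows.Three

/-! ## 1. Generic: derivative of a continuous implicit branch -/

/-- **DERIVATIVE OF A CONTINUOUS IMPLICIT BRANCH.**  Let `F : ℝ → ℝ → ℝ` have partial derivatives `F_T`, `F_x` everywhere, jointly continuous; let `φ` be
continuous on an open set `s` with `F(T, φ T) = 0` for `T ∈ s`; let `T₀ ∈ s` with `F_x(T₀, φ T₀) ≠ 0`.  Then `φ` has derivative `−F_T(T₀,φ T₀)/F_x(T₀,φ T₀)`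
at `T₀`. [folklore] -/
theorem implicit_hasDerivAt {F FT Fx : ℝ → ℝ → ℝ}
    (hT : ∀ T x : ℝ, HasDerivAt (fun T' => F T' x) (FT T x) T)
    (hx : ∀ T x : ℝ, HasDerivAt (fun x' => F T x') (Fx T x) x)
    (cT : Continuous (fun p : ℝ × ℝ => FT p.1 p.2)) (cx : Continuous (fun p : ℝ × ℝ => Fx p.1 p.2))
    {φ : ℝ → ℝ} {s : Set ℝ} (hs : IsOpen s) (hφc : ContinuousOn φ s) (hF0 : ∀ T ∈ s, F T (φ T) = 0)
    {T₀ : ℝ} (hT₀ : T₀ ∈ s) (hFx : Fx T₀ (φ T₀) ≠ 0) :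
    HasDerivAt φ (-(FT T₀ (φ T₀)) / Fx T₀ (φ T₀)) T₀ := by
  let f₁ : ℝ → ℝ → ℝ →L[ℝ] ℝ := fun T x => (FT T x) • (1 : ℝ →L[ℝ] ℝ)
  let f₂ : ℝ → ℝ → ℝ →L[ℝ] ℝ := fun T x => (Fx T x) • (1 : ℝ →L[ℝ] ℝ)
  have df₁ : ∀ᶠ v in 𝓝 (T₀, φ T₀), HasFDerivAt (F · v.2) (f₁ v.1 v.2) v.1 := by
    refine Filter.Eventually.of_forall fun v => ?_
    refine (hT v.1 v.2).hasFDerivAt.congr_fderiv ?_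
    ext; simp [f₁]
  have df₂ : ∀ᶠ v in 𝓝 (T₀, φ T₀), HasFDerivAt (F v.1 ·) (f₂ v.1 v.2) v.2 := by
    refine Filter.Eventually.of_forall fun v => ?_
    refine (hx v.1 v.2).hasFDerivAt.congr_fderiv ?_
    ext; simp [f₂]
  have cf₁ : ContinuousAt ↿f₁ (T₀, φ T₀) := by
    have : Continuous (↿f₁) := by
      show Continuous fun p : ℝ × ℝ => (FT p.1 p.2) • (1 : ℝ →L[ℝ] ℝ)
      exact cT.smul continuous_const
    exact this.continuousAt
  have cf₂ : ContinuousAt ↿f₂ (T₀, φ T₀) := by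
    have : Continuous (↿f₂) := by
      show Continuous fun p : ℝ × ℝ => (Fx p.1 p.2) • (1 : ℝ →L[ℝ] ℝ)
      exact cx.smul continuous_const
    exact this.continuousAt
  let e : ℝ ≃L[ℝ] ℝ := ContinuousLinearEquiv.equivOfInverse
    ((Fx T₀ (φ T₀)) • (1 : ℝ →L[ℝ] ℝ)) ((Fx T₀ (φ T₀))⁻¹ • (1 : ℝ →L[ℝ] ℝ))
    (fun y => by simp [hFx]) (fun y => by simp [hFx])
  have he : (e : ℝ →L[ℝ] ℝ) = f₂ (T₀, φ T₀).1 (T₀, φ T₀).2 := by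
    ext; simp [e, f₂]
  have if₂u : (f₂ (T₀, φ T₀).1 (T₀, φ T₀).2).IsInvertible := ⟨e, he⟩
  have key := eventually_apply_eq_iff_implicitFunctionOfBivariate df₁ df₂ cf₁ cf₂ if₂u
  have hder := hasStrictFDerivAt_implicitFunctionOfBivariate df₁ df₂ cf₁ cf₂ if₂u
  have hφT₀ : ContinuousAt φ T₀ := hφc.continuousAt (hs.mem_nhds hT₀)
  have htend : Tendsto (fun T => (T, φ T)) (𝓝 T₀) (𝓝 (T₀, φ T₀)) := by
    simpa using (continuous_id.tendsto T₀).prodMk_nhds hφT₀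
  have hev : φ =ᶠ[𝓝 T₀] implicitFunctionOfBivariate df₁ df₂ cf₁ cf₂ if₂u := by
    have h1 := htend.eventually key
    have h2 : ∀ᶠ T in 𝓝 T₀, T ∈ s := hs.mem_nhds hT₀
    filter_upwards [h1, h2] with T h1 h2
    have hF : F T (φ T) = F (T₀, φ T₀).1 (T₀, φ T₀).2 := by
      simp only
      rw [hF0 T h2, hF0 T₀ hT₀]
    exact (h1.mp hF).symm
  have hφ' := (hder.hasFDerivAt.congr_of_eventuallyEq hev).hasDerivAt
  refine hφ'.congr_deriv ?_
  have hinv : (f₂ (T₀, φ T₀).1 (T₀, φ T₀).2).inverse = (Fx T₀ (φ T₀))⁻¹ • (1 : ℝ →L[ℝ] ℝ) := by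
    rw [← he, ContinuousLinearMap.inverse_equiv]
    ext; simp [e]
  rw [hinv]
  simp [f₁, div_eq_inv_mul]
  ring

/-! ## 2. The branch-0 function is differentiable -/

set_option maxHeartbeats 400000 in
-- one long bookkeeping proof; about twice the default budget
/-- **THE BRANCH-0 FUNCTION IS DIFFERENTIABLE.**  Under the hypotheses of `branch0_function` (lone letter `j`, free pair `(i,k)`, window `(Tₘ, tⱼ)`), the
branch-0 function `φ` (positive, unique, strictly increasing, continuous) has, at every `T` of the window, the derivative `−F_T(T,φ T)/F_x(T,φ T)` of implicit
differentiation for `F(T,x) = wᵢx^{dᵢ}(−M_{ji}(T)) + wₖx^{dₖ}(−M_{jk}(T)) − w₀x^{d₀}(−M_{0j}(T))`, and `F_x(T, φ T) > 0`. [folklore] -/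
theorem branch0_hasDerivAt {a bi bk bj t₀ ti tk tj Tm w₀ wi wk : ℝ} {d₀ di dk : ℕ}
    (ha : 0 < a) (hbi : 0 < bi) (hbk : 0 < bk) (hbj : 0 < bj) (hti : 0 < ti) (htk : 0 < tk) (hi0 : ti < t₀) (hk0 : tk < t₀)
    (h0j : t₀ < tj) (hTm : t₀ ≤ Tm) (hQi : ∀ T : ℝ, Tm < T → (bj * (T + t₀) * (tj - T) - a * (T + tj) * (T - t₀)) < 0)
    (hw₀ : 0 < w₀) (hwi : 0 < wi) (hwk : 0 < wk) (h0i : d₀ < di) (h0k : d₀ < dk) :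
    ∃ φ : ℝ → ℝ,
      (∀ T : ℝ, Tm < T → T < tj → 0 < φ T ∧
        w₀ * (φ T) ^ d₀ * (-((T ^ (2:ℕ) - t₀ ^ (2:ℕ)) * (bj * (T - tj) ^ (2:ℕ)) - (T ^ (2:ℕ) - tj ^ (2:ℕ)) * (-a * (T - t₀) ^ (2:ℕ)))) = wi * (φ T) ^ di * (-((T ^ (2:ℕ) - tj ^ (2:ℕ)) * (bi * (T - ti) ^ (2:ℕ)) - (T ^ (2:ℕ) - ti ^ (2:ℕ)) * (bj * (T - tj) ^ (2:ℕ)))) + wk * (φ T) ^ dk * (-((T ^ (2:ℕ) - tj ^ (2:ℕ)) * (bk * (T - tk) ^ (2:ℕ)) - (T ^ (2:ℕ) - tk ^ (2:ℕ)) * (bj * (T - tj) ^ (2:ℕ))))) ∧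
      (∀ T x : ℝ, Tm < T → T < tj → 0 < x →
        w₀ * x ^ d₀ * (-((T ^ (2:ℕ) - t₀ ^ (2:ℕ)) * (bj * (T - tj) ^ (2:ℕ)) - (T ^ (2:ℕ) - tj ^ (2:ℕ)) * (-a * (T - t₀) ^ (2:ℕ)))) = wi * x ^ di * (-((T ^ (2:ℕ) - tj ^ (2:ℕ)) * (bi * (T - ti) ^ (2:ℕ)) - (T ^ (2:ℕ) - ti ^ (2:ℕ)) * (bj * (T - tj) ^ (2:ℕ)))) + wk * x ^ dk * (-((T ^ (2:ℕ) - tj ^ (2:ℕ)) * (bk * (T - tk) ^ (2:ℕ)) - (T ^ (2:ℕ) - tk ^ (2:ℕ)) * (bj * (T - tj) ^ (2:ℕ)))) → x = φ T) ∧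
      StrictMonoOn φ (Set.Ioo Tm tj) ∧ ContinuousOn φ (Set.Ioo Tm tj) ∧
      (∀ T : ℝ, Tm < T → T < tj →
        0 < wi * ((di : ℝ) * (φ T) ^ (di - 1)) * (-((T ^ (2:ℕ) - tj ^ (2:ℕ)) * (bi * (T - ti) ^ (2:ℕ)) - (T ^ (2:ℕ) - ti ^ (2:ℕ)) * (bj * (T - tj) ^ (2:ℕ)))) + wk * ((dk : ℝ) * (φ T) ^ (dk - 1)) * (-((T ^ (2:ℕ) - tj ^ (2:ℕ)) * (bk * (T - tk) ^ (2:ℕ)) - (T ^ (2:ℕ) - tk ^ (2:ℕ)) * (bj * (T - tj) ^ (2:ℕ))))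
              - w₀ * ((d₀ : ℝ) * (φ T) ^ (d₀ - 1)) * (-((T ^ (2:ℕ) - t₀ ^ (2:ℕ)) * (bj * (T - tj) ^ (2:ℕ)) - (T ^ (2:ℕ) - tj ^ (2:ℕ)) * (-a * (T - t₀) ^ (2:ℕ)))) ∧
        HasDerivAt φ
          (-(wi * (φ T) ^ di * (-((2 * T * (bi * (T - ti) ^ (2:ℕ)) + (T ^ (2:ℕ) - tj ^ (2:ℕ)) * (2 * bi * (T - ti))) - (2 * T * (bj * (T - tj) ^ (2:ℕ)) + (T ^ (2:ℕ) - ti ^ (2:ℕ)) * (2 * bj * (T - tj))))) + wk * (φ T) ^ dk * (-((2 * T * (bk * (T - tk) ^ (2:ℕ)) + (T ^ (2:ℕ) - tj ^ (2:ℕ)) * (2 * bk * (T - tk))) - (2 * T * (bj * (T - tj) ^ (2:ℕ)) + (T ^ (2:ℕ) - tk ^ (2:ℕ)) * (2 * bj * (T - tj))))) - w₀ * (φ T) ^ d₀ * (-((2 * T * (bj * (T - tj) ^ (2:ℕ)) + (T ^ (2:ℕ) - t₀ ^ (2:ℕ)) * (2 * bj * (T - tj))) - (2 * T * (-a * (T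 - t₀) ^ (2:ℕ)) + (T ^ (2:ℕ) - tj ^ (2:ℕ)) * (2 * (-a) * (T - t₀))))))
            / (wi * ((di : ℝ) * (φ T) ^ (di - 1)) * (-((T ^ (2:ℕ) - tj ^ (2:ℕ)) * (bi * (T - ti) ^ (2:ℕ)) - (T ^ (2:ℕ) - ti ^ (2:ℕ)) * (bj * (T - tj) ^ (2:ℕ)))) + wk * ((dk : ℝ) * (φ T) ^ (dk - 1)) * (-((T ^ (2:ℕ) - tj ^ (2:ℕ)) * (bk * (T - tk) ^ (2:ℕ)) - (T ^ (2:ℕ) - tk ^ (2:ℕ)) * (bj * (T - tj) ^ (2:ℕ))))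
                - w₀ * ((d₀ : ℝ) * (φ T) ^ (d₀ - 1)) * (-((T ^ (2:ℕ) - t₀ ^ (2:ℕ)) * (bj * (T - tj) ^ (2:ℕ)) - (T ^ (2:ℕ) - tj ^ (2:ℕ)) * (-a * (T - t₀) ^ (2:ℕ)))))) T) := by
  obtain ⟨φ, hφ, huniq, hmono, hcont⟩ :=
    branch0_function ha hbi hbk hbj hti htk hi0 hk0 h0j hTm hQi hw₀ hwi hwk h0i h0k
  refine ⟨φ, hφ, huniq, hmono, hcont, ?_⟩
  -- the defining function and its partial derivatives
  have hT : ∀ T x : ℝ, HasDerivAt (fun T' : ℝ =>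
        wi * x ^ di * (-((T' ^ (2:ℕ) - tj ^ (2:ℕ)) * (bi * (T' - ti) ^ (2:ℕ)) - (T' ^ (2:ℕ) - ti ^ (2:ℕ)) * (bj * (T' - tj) ^ (2:ℕ)))) + wk * x ^ dk * (-((T' ^ (2:ℕ) - tj ^ (2:ℕ)) * (bk * (T' - tk) ^ (2:ℕ)) - (T' ^ (2:ℕ) - tk ^ (2:ℕ)) * (bj * (T' - tj) ^ (2:ℕ)))) - w₀ * x ^ d₀ * (-((T' ^ (2:ℕ) - t₀ ^ (2:ℕ)) * (bj * (T' - tj) ^ (2:ℕ)) - (T' ^ (2:ℕ) - tj ^ (2:ℕ)) * (-a * (T' - t₀) ^ (2:ℕ)))))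
      (wi * x ^ di * (-((2 * T * (bi * (T - ti) ^ (2:ℕ)) + (T ^ (2:ℕ) - tj ^ (2:ℕ)) * (2 * bi * (T - ti))) - (2 * T * (bj * (T - tj) ^ (2:ℕ)) + (T ^ (2:ℕ) - ti ^ (2:ℕ)) * (2 * bj * (T - tj))))) + wk * x ^ dk * (-((2 * T * (bk * (T - tk) ^ (2:ℕ)) + (T ^ (2:ℕ) - tj ^ (2:ℕ)) * (2 * bk * (T - tk))) - (2 * T * (bj * (T - tj) ^ (2:ℕ)) + (T ^ (2:ℕ) - tk ^ (2:ℕ)) * (2 * bj * (T - tj))))) - w₀ * x ^ d₀ * (-((2 * T * (bj * (T - tj) ^ (2:ℕ)) + (T ^ (2:ℕ) - t₀ ^ (2:ℕ)) * (2 * bj * (T - tj))) - (2 * T * (-a * (T - t₀) ^ (2:ℕ)) + (T ^ (2:ℕ) - tj ^ (2:ℕ)) * (2 * (-a) * (T - t₀)))))) T := by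
    intro T x
    obtain ⟨hji, h0j, -⟩ := hasDerivAt_minors a bi bj t₀ ti tj T
    obtain ⟨hjk, -, -⟩ := hasDerivAt_minors a bk bj t₀ tk tj T
    exact ((hji.neg.const_mul (wi * x ^ di)).add (hjk.neg.const_mul (wk * x ^ dk))).sub (h0j.neg.const_mul (w₀ * x ^ d₀))
  have hx : ∀ T x : ℝ, HasDerivAt (fun x' : ℝ =>
        wi * x' ^ di * (-((T ^ (2:ℕ) - tj ^ (2:ℕ)) * (bi * (T - ti) ^ (2:ℕ)) - (T ^ (2:ℕ) - ti ^ (2:ℕ)) * (bj * (T - tj) ^ (2:ℕ)))) + wk * x' ^ dk * (-((T ^ (2:ℕ) - tj ^ (2:ℕ)) * (bk * (T - tk) ^ (2:ℕ)) - (T ^ (2:ℕ) - tk ^ (2:ℕ)) * (bj * (T - tj) ^ (2:ℕ)))) - w₀ * x' ^ d₀ * (-((T ^ (2:ℕ) - t₀ ^ (2:ℕ)) * (bj * (T - tj) ^ (2:ℕ)) - (T ^ (2:ℕ) - tj ^ (2:ℕ)) * (-a * (T - t₀) ^ (2:ℕ)))))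
      (wi * ((di : ℝ) * x ^ (di - 1)) * (-((T ^ (2:ℕ) - tj ^ (2:ℕ)) * (bi * (T - ti) ^ (2:ℕ)) - (T ^ (2:ℕ) - ti ^ (2:ℕ)) * (bj * (T - tj) ^ (2:ℕ)))) + wk * ((dk : ℝ) * x ^ (dk - 1)) * (-((T ^ (2:ℕ) - tj ^ (2:ℕ)) * (bk * (T - tk) ^ (2:ℕ)) - (T ^ (2:ℕ) - tk ^ (2:ℕ)) * (bj * (T - tj) ^ (2:ℕ))))
        - w₀ * ((d₀ : ℝ) * x ^ (d₀ - 1)) * (-((T ^ (2:ℕ) - t₀ ^ (2:ℕ)) * (bj * (T - tj) ^ (2:ℕ)) - (T ^ (2:ℕ) - tj ^ (2:ℕ)) * (-a * (T - t₀) ^ (2:ℕ))))) x := by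
    intro T x
    have p1 := ((hasDerivAt_pow di x).const_mul wi).mul_const (-((T ^ (2:ℕ) - tj ^ (2:ℕ)) * (bi * (T - ti) ^ (2:ℕ)) - (T ^ (2:ℕ) - ti ^ (2:ℕ)) * (bj * (T - tj) ^ (2:ℕ))))
    have p2 := ((hasDerivAt_pow dk x).const_mul wk).mul_const (-((T ^ (2:ℕ) - tj ^ (2:ℕ)) * (bk * (T - tk) ^ (2:ℕ)) - (T ^ (2:ℕ) - tk ^ (2:ℕ)) * (bj * (T - tj) ^ (2:ℕ))))
    have p3 := ((hasDerivAt_pow d₀ x).const_mul w₀).mul_const (-((T ^ (2:ℕ) - t₀ ^ (2:ℕ)) * (bj * (T - tj) ^ (2:ℕ)) - (T ^ (2:ℕ) - tj ^ (2:ℕ)) * (-a * (T - t₀) ^ (2:ℕ))))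
    exact (p1.add p2).sub p3
  have cT : Continuous (fun p : ℝ × ℝ =>
      wi * p.2 ^ di * (-((2 * p.1 * (bi * (p.1 - ti) ^ (2:ℕ)) + (p.1 ^ (2:ℕ) - tj ^ (2:ℕ)) * (2 * bi * (p.1 - ti))) - (2 * p.1 * (bj * (p.1 - tj) ^ (2:ℕ)) + (p.1 ^ (2:ℕ) - ti ^ (2:ℕ)) * (2 * bj * (p.1 - tj))))) + wk * p.2 ^ dk * (-((2 * p.1 * (bk * (p.1 - tk) ^ (2:ℕ)) + (p.1 ^ (2:ℕ) - tj ^ (2:ℕ)) * (2 * bk * (p.1 - tk))) - (2 * p.1 * (bj * (p.1 - tj) ^ (2:ℕ)) + (p.1 ^ (2:ℕ) - tk ^ (2:ℕ)) * (2 * bj * (p.1 - tj))))) - w₀ * p.2 ^ d₀ * (-((2 * p.1 * (bj * (p.1 - tj) ^ (2:ℕ)) + (p.1 ^ (2:ℕ) - t₀ ^ (2:ℕ)) * (2 * bj * (p.1 - tj))) - (2 * p.1 * (-a * (p.1 - t₀) ^ (2:ℕ)) + (p.1 ^ (2:ℕ) - tj ^ (2:ℕ)) * (2 * (-a) * (p.1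 - t₀)))))) := by
    fun_prop
  have cx : Continuous (fun p : ℝ × ℝ =>
      wi * ((di : ℝ) * p.2 ^ (di - 1)) * (-((p.1 ^ (2:ℕ) - tj ^ (2:ℕ)) * (bi * (p.1 - ti) ^ (2:ℕ)) - (p.1 ^ (2:ℕ) - ti ^ (2:ℕ)) * (bj * (p.1 - tj) ^ (2:ℕ)))) + wk * ((dk : ℝ) * p.2 ^ (dk - 1)) * (-((p.1 ^ (2:ℕ) - tj ^ (2:ℕ)) * (bk * (p.1 - tk) ^ (2:ℕ)) - (p.1 ^ (2:ℕ) - tk ^ (2:ℕ)) * (bj * (p.1 - tj) ^ (2:ℕ))))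
        - w₀ * ((d₀ : ℝ) * p.2 ^ (d₀ - 1)) * (-((p.1 ^ (2:ℕ) - t₀ ^ (2:ℕ)) * (bj * (p.1 - tj) ^ (2:ℕ)) - (p.1 ^ (2:ℕ) - tj ^ (2:ℕ)) * (-a * (p.1 - t₀) ^ (2:ℕ))))) := by
    fun_prop
  -- signs of the three negated minors on the window
  obtain ⟨q0neg, -, -, -, -, -⟩ := bracket_signs ha hbi hbj hti hi0 h0j
  obtain ⟨q0negk, -, -, -, -, -⟩ := bracket_signs ha hbk hbj htk hk0 h0j
  have signs : ∀ T : ℝ, Tm < T → T < tj → 0 < -((T ^ (2:ℕ) - t₀ ^ (2:ℕ)) * (bj * (T - tj) ^ (2:ℕ)) - (T ^ (2:ℕ) - tj ^ (2:ℕ)) * (-a * (T - t₀) ^ (2:ℕ))) ∧ 0 < -((T ^ (2:ℕ) - tj ^ (2:ℕ)) * (bi * (T - ti) ^ (2:ℕ)) - (T ^ (2:ℕ) - ti ^ (2:ℕ)) * (bj * (T - tj) ^ (2:ℕ))) ∧ 0 < -((T ^ (2:ℕ) - tj ^ (2:ℕ)) * (bk * (T - tk) ^ (2:ℕ)) - (T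 ^ (2:ℕ) - tk ^ (2:ℕ)) * (bj * (T - tj) ^ (2:ℕ))) := by
    intro T h1 h2
    obtain ⟨eji, e0j, -, -, -, -⟩ := minors_eq_neg_cross a bi bj t₀ ti tj T
    obtain ⟨ejk, -, -, -, -, -⟩ := minors_eq_neg_cross a bk bj t₀ tk tj T
    refine ⟨?_, ?_, ?_⟩
    · rw [e0j, neg_neg]; exact mul_pos_of_neg_of_neg (mul_neg_of_neg_of_pos (by linarith) (by linarith)) (hQi T h1)
    · rw [eji, neg_neg]; exact mul_pos_of_neg_of_neg (mul_neg_of_pos_of_neg (by linarith) (by linarith)) (q0neg T (by linarith) h2)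
    · rw [ejk, neg_neg]; exact mul_pos_of_neg_of_neg (mul_neg_of_pos_of_neg (by linarith) (by linarith)) (q0negk T (by linarith) h2)
  intro T h1 h2
  obtain ⟨hφpos, eφ⟩ := hφ T h1 h2
  obtain ⟨hP, hQ, hR⟩ := signs T h1 h2
  -- `F_x > 0` on the branch
  have hFx : 0 < wi * ((di : ℝ) * (φ T) ^ (di - 1)) * (-((T ^ (2:ℕ) - tj ^ (2:ℕ)) * (bi * (T - ti) ^ (2:ℕ)) - (T ^ (2:ℕ) - ti ^ (2:ℕ)) * (bj * (T - tj) ^ (2:ℕ)))) + wk * ((dk : ℝ) * (φ T) ^ (dk - 1)) * (-((T ^ (2:ℕ) - tj ^ (2:ℕ)) * (bk * (T - tk) ^ (2:ℕ)) - (T ^ (2:ℕ) - tk ^ (2:ℕ)) * (bj * (T - tj) ^ (2:ℕ))))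
      - w₀ * ((d₀ : ℝ) * (φ T) ^ (d₀ - 1)) * (-((T ^ (2:ℕ) - t₀ ^ (2:ℕ)) * (bj * (T - tj) ^ (2:ℕ)) - (T ^ (2:ℕ) - tj ^ (2:ℕ)) * (-a * (T - t₀) ^ (2:ℕ)))) := by
    have key : (φ T) * (wi * ((di : ℝ) * (φ T) ^ (di - 1)) * (-((T ^ (2:ℕ) - tj ^ (2:ℕ)) * (bi * (T - ti) ^ (2:ℕ)) - (T ^ (2:ℕ) - ti ^ (2:ℕ)) * (bj * (T - tj) ^ (2:ℕ)))) + wk * ((dk : ℝ) * (φ T) ^ (dk - 1)) * (-((T ^ (2:ℕ) - tj ^ (2:ℕ)) * (bk * (T - tk) ^ (2:ℕ)) - (T ^ (2:ℕ) - tk ^ (2:ℕ)) * (bj * (T - tj) ^ (2:ℕ))))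
        - w₀ * ((d₀ : ℝ) * (φ T) ^ (d₀ - 1)) * (-((T ^ (2:ℕ) - t₀ ^ (2:ℕ)) * (bj * (T - tj) ^ (2:ℕ)) - (T ^ (2:ℕ) - tj ^ (2:ℕ)) * (-a * (T - t₀) ^ (2:ℕ)))))
        = wi * (((di : ℝ) - d₀) * (φ T) ^ di) * (-((T ^ (2:ℕ) - tj ^ (2:ℕ)) * (bi * (T - ti) ^ (2:ℕ)) - (T ^ (2:ℕ) - ti ^ (2:ℕ)) * (bj * (T - tj) ^ (2:ℕ)))) + wk * (((dk : ℝ) - d₀) * (φ T) ^ dk) * (-((T ^ (2:ℕ) - tj ^ (2:ℕ)) * (bk * (T - tk) ^ (2:ℕ)) - (T ^ (2:ℕ) - tk ^ (2:ℕ)) * (bj * (T - tj) ^ (2:ℕ)))) := by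
      have e1 := SecularRolle.mul_natCast_mul_pow_pred (φ T) di
      have e2 := SecularRolle.mul_natCast_mul_pow_pred (φ T) dk
      have e3 := SecularRolle.mul_natCast_mul_pow_pred (φ T) d₀
      have : (φ T) * (wi * ((di : ℝ) * (φ T) ^ (di - 1)) * (-((T ^ (2:ℕ) - tj ^ (2:ℕ)) * (bi * (T - ti) ^ (2:ℕ)) - (T ^ (2:ℕ) - ti ^ (2:ℕ)) * (bj * (T - tj) ^ (2:ℕ)))) + wk * ((dk : ℝ) * (φ T) ^ (dk - 1)) * (-((T ^ (2:ℕ) - tj ^ (2:ℕ)) * (bk * (T - tk) ^ (2:ℕ)) - (T ^ (2:ℕ) - tk ^ (2:ℕ)) * (bj * (T - tj) ^ (2:ℕ))))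
          - w₀ * ((d₀ : ℝ) * (φ T) ^ (d₀ - 1)) * (-((T ^ (2:ℕ) - t₀ ^ (2:ℕ)) * (bj * (T - tj) ^ (2:ℕ)) - (T ^ (2:ℕ) - tj ^ (2:ℕ)) * (-a * (T - t₀) ^ (2:ℕ)))))
          = wi * ((φ T) * ((di : ℝ) * (φ T) ^ (di - 1))) * (-((T ^ (2:ℕ) - tj ^ (2:ℕ)) * (bi * (T - ti) ^ (2:ℕ)) - (T ^ (2:ℕ) - ti ^ (2:ℕ)) * (bj * (T - tj) ^ (2:ℕ)))) + wk * ((φ T) * ((dk : ℝ) * (φ T) ^ (dk - 1))) * (-((T ^ (2:ℕ) - tj ^ (2:ℕ)) * (bk * (T - tk) ^ (2:ℕ)) - (T ^ (2:ℕ) - tk ^ (2:ℕ)) * (bj * (T - tj) ^ (2:ℕ))))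
            - w₀ * ((φ T) * ((d₀ : ℝ) * (φ T) ^ (d₀ - 1))) * (-((T ^ (2:ℕ) - t₀ ^ (2:ℕ)) * (bj * (T - tj) ^ (2:ℕ)) - (T ^ (2:ℕ) - tj ^ (2:ℕ)) * (-a * (T - t₀) ^ (2:ℕ)))) := by ring
      rw [this, e1, e2, e3]
      linear_combination (-(d₀ : ℝ)) * eφ
    have hdi : (0 : ℝ) < (di : ℝ) - d₀ := by
      have : (d₀ : ℝ) < di := by exact_mod_cast h0i
      linarith
    have hdk : (0 : ℝ) < (dk : ℝ) - d₀ := by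
      have : (d₀ : ℝ) < dk := by exact_mod_cast h0k
      linarith
    have hrhs : 0 < wi * (((di : ℝ) - d₀) * (φ T) ^ di) * (-((T ^ (2:ℕ) - tj ^ (2:ℕ)) * (bi * (T - ti) ^ (2:ℕ)) - (T ^ (2:ℕ) - ti ^ (2:ℕ)) * (bj * (T - tj) ^ (2:ℕ)))) + wk * (((dk : ℝ) - d₀) * (φ T) ^ dk) * (-((T ^ (2:ℕ) - tj ^ (2:ℕ)) * (bk * (T - tk) ^ (2:ℕ)) - (T ^ (2:ℕ) - tk ^ (2:ℕ)) * (bj * (T - tj) ^ (2:ℕ)))) := by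
      have : 0 < wi * (((di : ℝ) - d₀) * (φ T) ^ di) * (-((T ^ (2:ℕ) - tj ^ (2:ℕ)) * (bi * (T - ti) ^ (2:ℕ)) - (T ^ (2:ℕ) - ti ^ (2:ℕ)) * (bj * (T - tj) ^ (2:ℕ)))) := mul_pos (mul_pos hwi (mul_pos hdi (pow_pos hφpos _))) hQ
      have : 0 < wk * (((dk : ℝ) - d₀) * (φ T) ^ dk) * (-((T ^ (2:ℕ) - tj ^ (2:ℕ)) * (bk * (T - tk) ^ (2:ℕ)) - (T ^ (2:ℕ) - tk ^ (2:ℕ)) * (bj * (T - tj) ^ (2:ℕ)))) := mul_pos (mul_pos hwk (mul_pos hdk (pow_pos hφpos _))) hR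
      linarith
    rw [← key] at hrhs
    exact pos_of_mul_pos_right hrhs hφpos.le
  refine ⟨hFx, ?_⟩
  have hF0 : ∀ T' ∈ Set.Ioo Tm tj,
      wi * (φ T') ^ di * (-((T' ^ (2:ℕ) - tj ^ (2:ℕ)) * (bi * (T' - ti) ^ (2:ℕ)) - (T' ^ (2:ℕ) - ti ^ (2:ℕ)) * (bj * (T' - tj) ^ (2:ℕ)))) + wk * (φ T') ^ dk * (-((T' ^ (2:ℕ) - tj ^ (2:ℕ)) * (bk * (T' - tk) ^ (2:ℕ)) - (T' ^ (2:ℕ) - tk ^ (2:ℕ)) * (bj * (T' - tj) ^ (2:ℕ)))) - w₀ * (φ T') ^ d₀ * (-((T' ^ (2:ℕ) - t₀ ^ (2:ℕ)) * (bj * (T' - tj) ^ (2:ℕ)) - (T' ^ (2:ℕ) - tj ^ (2:ℕ)) * (-a * (T' - t₀) ^ (2:ℕ)))) = 0 := by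
    intro T' hT'
    obtain ⟨-, e'⟩ := hφ T' hT'.1 hT'.2
    linarith
  exact implicit_hasDerivAt hT hx cT cx isOpen_Ioo hcont hF0 ⟨h1, h2⟩ (ne_of_gt hFx)

end Summit.ValiantsHypothesis.ValiantsHypothesis.Theorems.LacunarySymmetroidMatrixDescartes.Pivot.CriticalWindows.Four
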